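import Mathlib
import Literature.Computability.Complexity.ExtMonotoneGates
import Literature.Computability.Complexity.CliqueApproximatorsWide
import Literature.Computability.Complexity.RossmanMonotoneCliqueProb
import Summits.PneNP.PneNP.Theses.ConvexRankGates

/-!
# drefute: the exact shape of an `SGAt` counterexample (weak one-gate detector)

For the lead of line `dnf-invariant-wide-gates-see-small-cliques` (crux stmt-PneNP-10681).
`not_sgAt_of_detector`: a term gate `O` violates `SGAt m P l k q ε` as soon as
(A) it accepts more than `ε·C(m,k)` bare `k`-cliques, and
(B) for EVERY small vertex set `X ∈ 𝒱(l)` the event `[O = 0 ∧ ⌈X⌉]` has `G(m,q)`-mass `> ε`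
    (equivalently `q^{#E(K_X)} · Pr[O(G ∪ K_X) = 0] > ε`; `X = ∅` gives `Pr[O(G)=0] > ε`).
Conversely (`sgAt_witness_cases`) any SG-witness `𝒜` is `∅` (so (A) fails) or contains some `X` with
`Pr[O = 0 ∧ ⌈X⌉] ≤ ε` (so (B) fails at that `X`). Hence refuting `stub_sgPerm`/`stub_sgGRank` is EXACTLY
exhibiting, for some `c` and infinitely many `m`, one PERM/GRANK term gate of parameter `m^c` over
`≤ lOf m`-atoms that is a weak one-sided detector in the sense (A)+(B) with `ε = m^{-(c+1)}/4`.
-/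

set_option linter.dupNamespace false

namespace Summit.PneNP.PneNP.Cruxes.LinAlgGateBlind.DnfInvariantWideGatesSeeSmallCliques.Drefute

open Finset Literature.Computability.Complexity Razborov

noncomputable section

/-! ### Verbatim copies of the skeleton's §2 definitions (the Lines file is not an importable module);
paste the two theorems below into §3 of the skeleton, where these names resolve to the originals. -/

open Classical in
/-- (copy of the skeleton's `atomB`) -/
def atomB {m : ℕ} (X : Finset (Fin m)) (x : KEdge m → Bool) : Bool := decide (CliquePresent X x)

/-- (copy of the skeleton's `IsTermGate`) -/
def IsTermGate (m : ℕ) (P : GateFn → Prop) (l : ℕ) (O : (KEdge m → Bool) → Bool) : Prop :=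
  ∃ g : GateFn, P g ∧ ∃ X : Fin g.1 → Finset (Fin m),
    (∀ a, X a ∈ smallSets (Fin m) l) ∧ ∀ x, O x = g.2 (fun a => atomB (X a) x)

open Classical in
/-- (copy of the skeleton's `lostPos`) -/
def lostPos (m k : ℕ) (O : (KEdge m → Bool) → Bool) (𝒜 : Finset (Finset (Fin m))) :
    Finset (Finset (Fin m)) :=
  (powersetCard k (univ : Finset (Fin m))).filter fun S =>
    O (cliqueVec S) = true ∧ ¬ Accepts 𝒜 (cliqueVec S)

/-- (copy of the skeleton's `gainedNeg`) -/
def gainedNeg (m : ℕ) (q : ℝ) (O : (KEdge m → Bool) → Bool) (𝒜 : Finset (Finset (Fin m))) : ℝ :=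
  prob q (fun x : KEdge m → Bool => O x = false ∧ Accepts 𝒜 x)

/-- (copy of the skeleton's `SGAt`) -/
def SGAt (m : ℕ) (P : GateFn → Prop) (l k : ℕ) (q ε : ℝ) : Prop :=
  ∀ O : (KEdge m → Bool) → Bool, IsTermGate m P l O →
    ∃ 𝒜 ⊆ smallSets (Fin m) l,
      (#(lostPos m k O 𝒜) : ℝ) ≤ ε * (m.choose k : ℝ) ∧ gainedNeg m q O 𝒜 ≤ ε

open Classical in
/-- **SG fails for a weak detector.** If a term gate `O` accepts more than `ε·C(m,k)` bare
`k`-cliques and, for every `X ∈ 𝒱(l)`, `Pr_{G(m,q)}[O(G) = 0 ∧ K_X ⊆ G] > ε`, then no small-clique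
DNF `⌈𝒜⌉`, `𝒜 ⊆ 𝒱(l)`, approximates `O` one-sidedly within `ε`: `𝒜 = ∅` loses every accepted clique,
and any `X ∈ 𝒜` alone already gains more than `ε`. -/
theorem not_sgAt_of_detector {m : ℕ} {P : GateFn → Prop} {l k : ℕ} {q ε : ℝ} (hq0 : 0 ≤ q)
    (hq1 : q ≤ 1) (O : (KEdge m → Bool) → Bool) (hO : IsTermGate m P l O)
    (hA : ε * (m.choose k : ℝ) <
      (#((powersetCard k (univ : Finset (Fin m))).filter fun S => O (cliqueVec S) = true) : ℝ))
    (hB : ∀ X ∈ smallSets (Fin m) l,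
      ε < prob q (fun x : KEdge m → Bool => O x = false ∧ CliquePresent X x)) :
    ¬ SGAt m P l k q ε := by
  intro hSG
  obtain ⟨𝒜, h𝒜, hlost, hgain⟩ := hSG O hO
  rcases 𝒜.eq_empty_or_nonempty with rfl | ⟨X, hX⟩
  · -- `𝒜 = ∅`: every accepted clique is lost
    have heq : lostPos m k O ∅ =
        (powersetCard k (univ : Finset (Fin m))).filter fun S => O (cliqueVec S) = true := by
      unfold lostPos
      refine filter_congr fun S _ => ?_
      simp [Accepts]
    rw [heq] at hlost
    exact absurd (lt_of_lt_of_le hA hlost) (lt_irrefl _)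
  · -- `X ∈ 𝒜`: the event `[O = 0 ∧ ⌈X⌉]` is already gained
    have hle : prob q (fun x : KEdge m → Bool => O x = false ∧ CliquePresent X x) ≤
        gainedNeg m q O 𝒜 := by
      unfold gainedNeg
      exact prob_mono hq0 hq1 fun x hx => ⟨hx.1, X, hX, hx.2⟩
    exact absurd (lt_of_lt_of_le (hB X (h𝒜 hX)) (hle.trans hgain)) (lt_irrefl _)

/-- **Shape of any SG witness.** A family `𝒜` witnessing `SGAt` for `O` is either empty — then `O`
accepts at most `ε·C(m,k)` bare `k`-cliques — or contains some `X ∈ 𝒱(l)` with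
`Pr[O = 0 ∧ ⌈X⌉] ≤ ε` (planting the small clique `K_X` forces `O` to accept up to mass `ε`). -/
theorem sgAt_witness_cases {m : ℕ} {l k : ℕ} {q ε : ℝ} (hq0 : 0 ≤ q) (hq1 : q ≤ 1)
    (O : (KEdge m → Bool) → Bool) {𝒜 : Finset (Finset (Fin m))} (h𝒜 : 𝒜 ⊆ smallSets (Fin m) l)
    (hlost : (#(lostPos m k O 𝒜) : ℝ) ≤ ε * (m.choose k : ℝ)) (hgain : gainedNeg m q O 𝒜 ≤ ε) :
    (#((powersetCard k (univ : Finset (Fin m))).filter fun S => O (cliqueVec S) = true) : ℝ)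
        ≤ ε * (m.choose k : ℝ) ∨
      ∃ X ∈ smallSets (Fin m) l,
        prob q (fun x : KEdge m → Bool => O x = false ∧ CliquePresent X x) ≤ ε := by
  classical
  rcases 𝒜.eq_empty_or_nonempty with rfl | ⟨X, hX⟩
  · left
    have heq : lostPos m k O ∅ =
        (powersetCard k (univ : Finset (Fin m))).filter fun S => O (cliqueVec S) = true := by
      unfold lostPos
      refine filter_congr fun S _ => ?_
      simp [Accepts]
    rwa [heq] at hlost
  · right
    refine ⟨X, h𝒜 hX, le_trans ?_ hgain⟩
    unfold gainedNeg
    exact prob_mono hq0 hq1 fun x hx => ⟨hx.1, X, hX, hx.2⟩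

end

end Summit.PneNP.PneNP.Cruxes.LinAlgGateBlind.DnfInvariantWideGatesSeeSmallCliques.Drefute
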